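import Literature.MathematicalPhysics.QuantumFieldTheory.Balaban1983to89.B9Eq319BumpProfile

/-!
# `Balaban1983to89.B9Eq319BumpProfileCos` — T. Bałaban, *Propagators for lattice gauge theories in a background field*, Commun. Math. Phys. **99**
# (1985) 389–434 [Balaban1985BackgroundPropagators] (3.19) p. 393 with (3.88)–(3.89) p. 409, (3.100) p. 413, and [Balaban1985Averaging] (2) p. 17: **A BUMP
# PROFILE WITH BOUNDED SECOND DIFFERENCES — the cosine bump `φ(x) = (L∕(L−1))^d·Π_ν (1 − cos(2πk_ν(x)∕(L−1)))` on the blocks of the fine torus: exact block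
# mean `Σ_{x∈B(y)} L^{−d}φ(x) = 1`, face-vanishing TO SECOND ORDER (`φ = 0` at offsets `0` and `L−1`), `|φ| ≤ 3^d`, first differences `≤ (2π∕(L−1))·(3∕2)·3^{d−1}`
# on EVERY bond, and SECOND differences `≤ (2π∕(L−1))²·(3∕2)·3^{d−1}` at EVERY site INCLUDING the block faces** — the five profile letters of
# `B9Eq319BumpProfile.exists_bumpProfile` (so `B9Eq319BumpSection` ∕ `B9Eq319ContourAxialGauge` ∕ `B9Eq319BumpSectionTorus` consume it unchanged) PLUS the
# second-difference letter the parabolic tent lacks (its profile `k(L−1−k)` has a corner of size `6∕(L−1)` at every face), which is what makes the LAPLACIAN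
# of a bump section `‖Δ^η_U Ψg‖` — the `C_Ψ` of S-P6′(β) `B9Eq387CubeLocalisedProjection.norm_sub_projR_cube_le(_weighted)` — `η`-free

statement-level skeleton of published theorems with citation tags; proofs where landed; nothing here is a claim about the Yang–Mills mass gap

CITATION HEADER (lean-in-tree rule).  Audit cell `pub-balaban`, sub-cell `t4`, BINDER row NE9; filed by NE9 formalisation-swarm leaf prover 05
(`b2b-balaban-t4-ne9-formalise-leaf-05`, gen 75), the lineage of `B9Eq319BumpProfile` (gen 73, the normalised tent) and of the K6 port `B9Eq319BumpSection`
(gen 72).  Source READ in the held text (`paper:balaban1985-cmp99-background-propagators`): p. 393 (3.19) (the block averaging `Q′` whose right inverse a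
bump section is); p. 409 (3.88)–(3.89) (print's commutator `K(h)` and the `O(M⁻¹)` it costs «on a proper scale» — smoothness of the cut-offs ∕ sections is
what the scale-free constants rest on); p. 413 (3.100) («coefficients determined by derivatives of the function h»); [Balaban1985Averaging] p. 17 (2) (the
blocks `B(y)`).  Print never writes a section profile down; the cosine bump is this file's [folklore] choice, made so that BOTH difference letters are
`O(L⁻¹)`, `O(L⁻²)` uniformly, faces included.
WHY (cell context).  S-P6′(β)'s displayed hypothesis `hCΨ : ‖Δs(Ψg)‖ ≤ C_Ψ‖g‖` is the LAPLACIAN of the section (`Δs = D†D`), not the energy letter `‖DΨg‖`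
of kernel 5 ∕ row L8: with `c = η⁻¹` per difference it is `η`-free exactly when the profile's SECOND differences are `O(L⁻²)` (`Lη = 1`).  The tent of
`B9Eq319BumpProfile` vanishes to FIRST order at the faces (values `6∕(L−1), 0 | 0, 6∕(L−1)` across a face: second difference `6∕(L−1)`), so its section
has `‖ΔsΨ‖ = O(√L)`; the cosine bump vanishes to second order (`1 − cos u ≈ u²∕2` at `u = 0` and `u = 2π`), so its second differences are `≤ (L∕(L−1))θ²`,
`θ = 2π∕(L−1)`, at interior sites (the identity `cos(a+θ) − 2cos a + cos(a−θ) = −2cos a(1 − cos θ)`) AND at both face sites (where the lattice profile reads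
`q(L−2), 0, 0, q(1)` and `q(1) = q(L−2) = (L∕(L−1))(1 − cos θ) ≤ (L∕(L−1))θ²∕2`).  The exact block mean uses `Σ_{k<L−1} cos(2πk∕(L−1)) = 0` (`L ≥ 3`; the
real part of the vanishing sum of the `(L−1)`-th roots of unity, `IsPrimitiveRoot.geom_sum_eq_zero`) and `cos 2π = 1`.
WHAT IS PROVED (sorry-free; proof lane — no `def`, the profile is written out in every statement; [folklore] trigonometry + offset bookkeeping BY NAME over
`B9Eq319BlockTentLift` ∕ `B5Eq155FlatAveragingCommute`; nothing of [B9] asserted):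
§1 trigonometric letters (`cos_second_diff_eq`, `abs_cos_second_diff_le`, `sum_cos_two_pi_div_eq_zero`, `sum_one_sub_cos_eq`; `1 − cos h ≤ h²∕2` is Mathlib's `Real.one_sub_sq_div_two_le_cos`);
§2 the one-coordinate lattice profile with restart at the faces (`latt_first_diff_le`, `latt_second_diff_le`); §3 the cosine bump on the torus:
**`bumpProfileCos_sum`** (`hφ`), **`abs_bumpProfileCos_le`** (`hΦ`), **`abs_bumpProfileCos_step_le`** (`hφlip`, every bond), **`bumpProfileCos_cross`** (`hcross`),
**`abs_bumpProfileCos_second_diff_le`** (NEW: the centred second difference `|(φ(y) − φ(y−e_μ)) − (φ(y+e_μ) − φ(y))|` in the shape of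
`B9Eq388KhCommutatorLattice.norm_lap_comm_le`'s `h2`), **`exists_bumpProfileCos`** (the six letters at once, `L ≥ 3`); §4 `L`-uniform constants.
HONEST SCOPE.  A profile and its letters; the section built on it and the Laplacian letter of that section (`‖Δs(Ψg)‖ ≤ C_Ψ‖g‖`, `η`-free) are the sequel
(K6's `norm_covDeriv_bumpSection_le` one order up); NOT NE9 (cell pub-balaban: NE9 NOT PRINTED ∕ NOT PROVED; «NE9 ⇐ the named binders»; spine PROVED 0∕9;
rung (B)+1 on a finite T⁴ — NOT infinite volume, NOT mass gap, NOT Clay; HONEST DEPENDENCY: continuum YM on T⁴ ⇐ BetaPertH ∧ nine spine estimates (0/9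
proved); BetaPertH ⇐ (D1) ∧ (D4) ∧ CAP+tail; G-an2-4 gates asym, D1 and NE2/3/4).  NEW file importing `B9Eq319BumpProfile` only; nothing modified.  Net new
unproved facts: 0.
-/

noncomputable section

open Finset

namespace Literature.MathematicalPhysics.QuantumFieldTheory.Balaban1983to89.B9Eq319BumpProfileCos

open B4Sect5Torus (TSite)
open B9SectCLatticeCarrier (Bond bpos btgt shift unshift shift_unshift)
open B9Eq319QprimeTorus (fineP blockCoord offset offset_lt)
open B9Eq319BlockTentLift (offset_shift_self offset_shift_of_ne blockCoord_shift_of_lt offset_shift_of_eq)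
open B5Eq155FlatAveragingCommute (sum_blockOf_eq_sum_boxVec offset_perSite_cornerSite_add_boxVec)

/-! ## §1 Trigonometric letters -/
section Trig

/-- `cos(a + h) − 2cos a + cos(a − h) = −2cos a·(1 − cos h)`. [folklore] [cite: Balaban1985BackgroundPropagators, (3.100) p.413] -/
theorem cos_second_diff_eq (a h : ℝ) : Real.cos (a + h) - 2 * Real.cos a + Real.cos (a - h) = -(2 * Real.cos a * (1 - Real.cos h)) := by
  rw [Real.cos_add, Real.cos_sub]; ring

/-- **the symmetric second difference of the cosine is `≤ h²`**: `|cos(a + h) − 2cos a + cos(a − h)| ≤ h²`. [folklore] [cite: Balaban1985BackgroundPropagators, (3.100) p.413] -/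
theorem abs_cos_second_diff_le (a h : ℝ) : |Real.cos (a + h) - 2 * Real.cos a + Real.cos (a - h)| ≤ h ^ 2 := by
  rw [cos_second_diff_eq, abs_neg, abs_mul, abs_mul, abs_of_nonneg (sub_nonneg.2 (Real.cos_le_one h)), abs_two]
  have hh : 1 - Real.cos h ≤ h ^ 2 / 2 := by have := Real.one_sub_sq_div_two_le_cos (x := h); linarith
  calc 2 * |Real.cos a| * (1 - Real.cos h) ≤ 2 * 1 * (h ^ 2 / 2) :=
        mul_le_mul (mul_le_mul_of_nonneg_left (Real.abs_cos_le_one a) zero_le_two) hh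
          (sub_nonneg.2 (Real.cos_le_one h)) (by norm_num)
    _ = h ^ 2 := by ring

/-- **THE FULL-PERIOD COSINE SUM VANISHES**: `Σ_{k<N} cos(2πk∕N) = 0` for `N ≥ 2` — the real part of the vanishing sum of the `N`-th roots of unity
(`IsPrimitiveRoot.geom_sum_eq_zero`). [folklore] [cite: Balaban1985Averaging, (2) p.17] -/
theorem sum_cos_two_pi_div_eq_zero {N : ℕ} (hN : 2 ≤ N) : ∑ k ∈ Finset.range N, Real.cos (2 * Real.pi / (N : ℝ) * (k : ℝ)) = 0 := by
  have hN0 : N ≠ 0 := by omega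
  have hζ := Complex.isPrimitiveRoot_exp N hN0
  have hsum := hζ.geom_sum_eq_zero (by omega : 1 < N)
  have hre : (∑ k ∈ Finset.range N, Complex.exp (2 * Real.pi * Complex.I / N) ^ k).re =
      ∑ k ∈ Finset.range N, Real.cos (2 * Real.pi / (N : ℝ) * (k : ℝ)) := by
    rw [Complex.re_sum]
    refine Finset.sum_congr rfl fun k _ => ?_
    rw [← Complex.exp_nat_mul, show (k : ℂ) * (2 * Real.pi * Complex.I / N) = ((2 * Real.pi / (N : ℝ) * (k : ℝ) : ℝ) : ℂ) * Complex.I by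
      push_cast; ring, Complex.exp_ofReal_mul_I_re]
  rw [← hre, hsum, Complex.zero_re]

/-- **THE ONE-COORDINATE MASS**: `Σ_{k<L} (1 − cos(2πk∕(L−1))) = L − 1` for `L ≥ 3` (the first `L − 1` cosines sum to `0`, the last is `cos 2π = 1`).
[folklore] [cite: Balaban1985Averaging, (2) p.17] -/
theorem sum_one_sub_cos_eq {L : ℕ} (hL : 3 ≤ L) :
    ∑ k ∈ Finset.range L, (1 - Real.cos (2 * Real.pi / ((L : ℝ) - 1) * (k : ℝ))) = (L : ℝ) - 1 := by
  obtain ⟨N, rfl⟩ : ∃ N, L = N + 1 := ⟨L - 1, by omega⟩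
  have hN : ((N + 1 : ℕ) : ℝ) - 1 = N := by push_cast; ring
  have hN0 : (N : ℝ) ≠ 0 := by exact_mod_cast (show N ≠ 0 by omega)
  rw [hN, Finset.sum_sub_distrib, Finset.sum_const, Finset.card_range, nsmul_eq_mul, mul_one, Finset.sum_range_succ,
    sum_cos_two_pi_div_eq_zero (by omega : 2 ≤ N), zero_add, show 2 * Real.pi / (N : ℝ) * (N : ℝ) = 2 * Real.pi by field_simp, Real.cos_two_pi]
  push_cast; ring

end Trig

/-! ## §2 The one-coordinate lattice profile `q(k) = 1 − cos(θk)`, `θ = 2π∕(L−1)`, restarted at every block (offsets `k < L`) -/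
section OneDim
variable {L : ℕ}

/-- `q(0) = 0` and `q(L−1) = 0`: the cosine bump vanishes at BOTH face offsets. [folklore] [cite: Balaban1985Averaging, (2) p.17] -/
theorem one_sub_cos_face (hL : 2 ≤ L) :
    1 - Real.cos (2 * Real.pi / ((L : ℝ) - 1) * ((0 : ℕ) : ℝ)) = 0 ∧ 1 - Real.cos (2 * Real.pi / ((L : ℝ) - 1) * ((L - 1 : ℕ) : ℝ)) = 0 := by
  have hL1 : ((L - 1 : ℕ) : ℝ) = (L : ℝ) - 1 := by rw [Nat.cast_sub (by omega)]; simp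
  have h2 : (2 : ℝ) ≤ L := by exact_mod_cast hL
  have hne : (L : ℝ) - 1 ≠ 0 := by linarith
  refine ⟨by simp, ?_⟩
  rw [hL1, div_mul_cancel₀ _ hne, Real.cos_two_pi, sub_self]

/-- `0 ≤ q ≤ 2`. [folklore] [cite: Balaban1985Averaging, (2) p.17] -/
theorem one_sub_cos_mem (t : ℝ) : 0 ≤ 1 - Real.cos t ∧ 1 - Real.cos t ≤ 2 :=
  ⟨sub_nonneg.2 (Real.cos_le_one t), by linarith [Real.neg_one_le_cos t]⟩

/-- **FIRST DIFFERENCES WITH RESTART**: for offsets `k, k′ < L` with `k′ = (k + 1) mod L`, `|q(k′) − q(k)| ≤ θ` (`θ = 2π∕(L−1) ≥ 0`; across the face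
`q(0) − q(L−1) = 0`). [folklore] [cite: Balaban1985BackgroundPropagators, (3.100) p.413; Balaban1985Averaging, (2) p.17] -/
theorem latt_first_diff_le (hL : 2 ≤ L) {k k' : ℕ} (hk : k < L) (hk' : k' = (k + 1) % L) :
    |(1 - Real.cos (2 * Real.pi / ((L : ℝ) - 1) * (k' : ℝ))) - (1 - Real.cos (2 * Real.pi / ((L : ℝ) - 1) * (k : ℝ)))| ≤
      2 * Real.pi / ((L : ℝ) - 1) := by
  have h2 : (2 : ℝ) ≤ L := by exact_mod_cast hL
  have hL1 : (1 : ℝ) ≤ (L : ℝ) - 1 := by linarith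
  have hθ : 0 ≤ 2 * Real.pi / ((L : ℝ) - 1) := div_nonneg (by positivity) (by linarith)
  rcases Nat.lt_or_ge (k + 1) L with hlt | hge
  · rw [hk', Nat.mod_eq_of_lt hlt]
    calc _ = |Real.cos (2 * Real.pi / ((L : ℝ) - 1) * (k : ℝ)) - Real.cos (2 * Real.pi / ((L : ℝ) - 1) * ((k + 1 : ℕ) : ℝ))| := by
          congr 1; ring
      _ ≤ |2 * Real.pi / ((L : ℝ) - 1) * (k : ℝ) - 2 * Real.pi / ((L : ℝ) - 1) * ((k + 1 : ℕ) : ℝ)| := Real.abs_cos_sub_cos_le _ _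
      _ = 2 * Real.pi / ((L : ℝ) - 1) := by push_cast; rw [← mul_sub, abs_mul, abs_of_nonneg hθ]; norm_num
  · have hkL : k = L - 1 := by omega
    have hk0 : k' = 0 := by rw [hk', show k + 1 = L by omega, Nat.mod_self]
    obtain ⟨h0, hlast⟩ := one_sub_cos_face hL
    rw [hk0, hkL, h0, hlast, sub_self, abs_zero]
    exact hθ

/-- **SECOND DIFFERENCES WITH RESTART**: for offsets `j, k, k′ < L` with `k = (j + 1) mod L`, `k′ = (k + 1) mod L` (three consecutive sites along one
coordinate), `|q(k′) − 2q(k) + q(j)| ≤ θ²` — at interior sites the cosine identity, at the two face sites `q(1) = q(L−2) = 1 − cos θ ≤ θ²∕2` next to the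
double zero. [folklore] [cite: Balaban1985BackgroundPropagators, (3.100) p.413, (3.88)–(3.89) p.409] -/
theorem latt_second_diff_le (hL : 3 ≤ L) {j k k' : ℕ} (hj : j < L) (hk : k = (j + 1) % L) (hk' : k' = (k + 1) % L) :
    |(1 - Real.cos (2 * Real.pi / ((L : ℝ) - 1) * (k' : ℝ))) - 2 * (1 - Real.cos (2 * Real.pi / ((L : ℝ) - 1) * (k : ℝ))) +
        (1 - Real.cos (2 * Real.pi / ((L : ℝ) - 1) * (j : ℝ)))| ≤ (2 * Real.pi / ((L : ℝ) - 1)) ^ 2 := by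
  set θ : ℝ := 2 * Real.pi / ((L : ℝ) - 1) with hθ
  have h3 : (3 : ℝ) ≤ L := by exact_mod_cast hL
  have hL2 : (2 : ℝ) ≤ (L : ℝ) - 1 := by linarith
  have hne : (L : ℝ) - 1 ≠ 0 := by linarith
  have hθL : θ * ((L : ℝ) - 1) = 2 * Real.pi := by rw [hθ]; field_simp
  -- `q(1) = q(L−2) = 1 − cos θ ≤ θ²∕2` (Mathlib's `Real.one_sub_sq_div_two_le_cos`)
  have hcosθ : 1 - Real.cos θ ≤ θ ^ 2 / 2 := by have := Real.one_sub_sq_div_two_le_cos (x := θ); linarith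
  have hq1 : |1 - Real.cos (θ * ((1 : ℕ) : ℝ))| ≤ θ ^ 2 := by
    rw [Nat.cast_one, mul_one, abs_of_nonneg (one_sub_cos_mem θ).1]
    linarith [hcosθ, sq_nonneg θ]
  have hqL2 : |1 - Real.cos (θ * ((L - 2 : ℕ) : ℝ))| ≤ θ ^ 2 := by
    have e : θ * ((L - 2 : ℕ) : ℝ) = 2 * Real.pi - θ := by
      rw [Nat.cast_sub (by omega), Nat.cast_two, mul_sub, hθL.symm]; ring
    rw [e, Real.cos_two_pi_sub, abs_of_nonneg (one_sub_cos_mem θ).1]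
    linarith [hcosθ, sq_nonneg θ]
  obtain ⟨h0, hlast⟩ := one_sub_cos_face (L := L) (by omega)
  rcases Nat.lt_or_ge (j + 1) L with hj1 | hj1
  · -- `k = j + 1`
    have hkj : k = j + 1 := by rw [hk, Nat.mod_eq_of_lt hj1]
    rcases Nat.lt_or_ge (k + 1) L with hk1 | hk1
    · -- interior: `k′ = k + 1`, the cosine identity at `a = θk`
      have hk'k : k' = k + 1 := by rw [hk', Nat.mod_eq_of_lt hk1]
      have e : (1 - Real.cos (θ * (k' : ℝ))) - 2 * (1 - Real.cos (θ * (k : ℝ))) + (1 - Real.cos (θ * (j : ℝ))) =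
          -(Real.cos (θ * k + θ) - 2 * Real.cos (θ * k) + Real.cos (θ * k - θ)) := by
        rw [hk'k, hkj]; push_cast; ring_nf
      rw [e, abs_neg]
      exact abs_cos_second_diff_le _ _
    · -- `k = L − 1`, `k′ = 0`, `j = L − 2`: the face from the left
      have hkL : k = L - 1 := by omega
      have hjL : j = L - 2 := by omega
      have hk0 : k' = 0 := by rw [hk', show k + 1 = L by omega, Nat.mod_self]
      rw [hk0, hkL, hjL, h0, hlast, mul_zero, sub_zero, zero_add]
      exact hqL2
  · -- `j = L − 1`, `k = 0`, `k′ = 1`: the face from the right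
    have hjL : j = L - 1 := by omega
    have hk0 : k = 0 := by rw [hk, show j + 1 = L by omega, Nat.mod_self]
    have hk1 : k' = 1 := by rw [hk', hk0, zero_add, Nat.mod_eq_of_lt (by omega : 1 < L)]
    rw [hk1, hk0, hjL, h0, hlast, mul_zero, sub_zero, add_zero]
    exact hq1

end OneDim

/-! ## §3 Products of a one-coordinate profile over the offsets: the block letters from the one-dimensional ones -/
section Product
variable {d : ℕ} (L : ℕ) [NeZero L] (m : Fin d → ℕ) (p : ℕ → ℝ)

omit [NeZero L] in
/-- splitting off the factor of direction `μ`. [folklore] [cite: Balaban1985Averaging, (2) p.17] -/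
theorem prod_offset_eq (x : TSite d (fineP L m)) (μ : Fin d) :
    ∏ ν, p (offset L m x ν) = p (offset L m x μ) * ∏ ν ∈ Finset.univ.erase μ, p (offset L m x ν) :=
  (Finset.mul_prod_erase Finset.univ (fun ν => p (offset L m x ν)) (Finset.mem_univ μ)).symm

omit [NeZero L] in
/-- after a step along `μ` only the `μ`-th offset moves, to `(k + 1) mod L`. [folklore] [cite: Balaban1985Averaging, (2) p.17] -/
theorem prod_offset_shift_eq (x : TSite d (fineP L m)) (μ : Fin d) :
    ∏ ν, p (offset L m (shift μ x) ν) = p ((offset L m x μ + 1) % L) * ∏ ν ∈ Finset.univ.erase μ, p (offset L m x ν) := by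
  rw [prod_offset_eq L m p (shift μ x) μ, offset_shift_self]
  congr 1
  exact Finset.prod_congr rfl fun ν hν => by rw [offset_shift_of_ne L m x (Finset.ne_of_mem_erase hν)]

omit [NeZero L] in
/-- before a step along `μ`: the `μ`-th offset `j` of `x − e_μ` has `(j + 1) mod L = k_μ(x)`, the others agree with `x`'s. [folklore]
[cite: Balaban1985Averaging, (2) p.17] -/
theorem prod_offset_unshift_eq (x : TSite d (fineP L m)) (μ : Fin d) :
    ∏ ν, p (offset L m (unshift μ x) ν) = p (offset L m (unshift μ x) μ) * ∏ ν ∈ Finset.univ.erase μ, p (offset L m x ν) ∧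
      offset L m x μ = (offset L m (unshift μ x) μ + 1) % L := by
  refine ⟨?_, ?_⟩
  · rw [prod_offset_eq L m p (unshift μ x) μ]
    congr 1
    refine Finset.prod_congr rfl fun ν hν => ?_
    have h := offset_shift_of_ne L m (unshift μ x) (Finset.ne_of_mem_erase hν)
    rw [shift_unshift] at h
    rw [h]
  · have h := offset_shift_self L m (unshift μ x) μ
    rwa [shift_unshift] at h

/-- the other `d − 1` factors are bounded by `P^{d−1}` when `|p k| ≤ P` on offsets. [folklore] [cite: Balaban1985Averaging, (2) p.17] -/
theorem abs_prod_erase_le {P : ℝ} (hP : ∀ k, k < L → |p k| ≤ P) (x : TSite d (fineP L m)) (μ : Fin d) :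
    |∏ ν ∈ Finset.univ.erase μ, p (offset L m x ν)| ≤ P ^ (d - 1) := by
  rw [Finset.abs_prod]
  calc ∏ ν ∈ Finset.univ.erase μ, |p (offset L m x ν)| ≤ ∏ _ν ∈ Finset.univ.erase μ, P :=
        Finset.prod_le_prod (fun ν _ => abs_nonneg _) fun ν _ => hP _ (offset_lt L m x ν)
    _ = P ^ (d - 1) := by rw [Finset.prod_const, Finset.card_erase_of_mem (Finset.mem_univ μ), Finset.card_univ, Fintype.card_fin]

/-- **SIZE**: `|Π_ν p(k_ν(x))| ≤ P^d`. [folklore] [cite: Balaban1985Averaging, (2) p.17] -/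
theorem abs_prod_offset_le {P : ℝ} (hP : ∀ k, k < L → |p k| ≤ P) (x : TSite d (fineP L m)) : |∏ ν, p (offset L m x ν)| ≤ P ^ d := by
  rw [Finset.abs_prod]
  calc ∏ ν, |p (offset L m x ν)| ≤ ∏ _ν : Fin d, P := Finset.prod_le_prod (fun ν _ => abs_nonneg _) fun ν _ => hP _ (offset_lt L m x ν)
    _ = P ^ d := by rw [Finset.prod_const, Finset.card_univ, Fintype.card_fin]

/-- **STEP ON EVERY BOND** from the one-dimensional restart letter `|p((k+1) mod L) − p(k)| ≤ ℓ₁`: `|Πp(k(x + e_μ)) − Πp(k(x))| ≤ ℓ₁P^{d−1}`. [folklore]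
[cite: Balaban1985BackgroundPropagators, (3.100) p.413; Balaban1985Averaging, (2) p.17] -/
theorem abs_prod_offset_shift_sub_le {P ℓ₁ : ℝ} (hP : ∀ k, k < L → |p k| ≤ P) (hℓ₁ : 0 ≤ ℓ₁)
    (h1 : ∀ k, k < L → |p ((k + 1) % L) - p k| ≤ ℓ₁) (x : TSite d (fineP L m)) (μ : Fin d) :
    |∏ ν, p (offset L m (shift μ x) ν) - ∏ ν, p (offset L m x ν)| ≤ ℓ₁ * P ^ (d - 1) := by
  rw [prod_offset_shift_eq L m p x μ, prod_offset_eq L m p x μ, ← sub_mul, abs_mul]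
  exact mul_le_mul (h1 _ (offset_lt L m x μ)) (abs_prod_erase_le L m p hP x μ) (abs_nonneg _) hℓ₁

/-- **CENTRED SECOND DIFFERENCE AT EVERY SITE** from the one-dimensional restart letter `|p(k′) − 2p(k) + p(j)| ≤ ℓ₂` (`k = (j+1) mod L`,
`k′ = (k+1) mod L`): `|(Πp(k(x)) − Πp(k(x − e_μ))) − (Πp(k(x + e_μ)) − Πp(k(x)))| ≤ ℓ₂P^{d−1}` — the `h2` shape of `B9Eq388KhCommutatorLattice.norm_lap_comm_le`.
[folklore] [cite: Balaban1985BackgroundPropagators, (3.100) p.413, (3.88)–(3.89) p.409] -/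
theorem abs_prod_offset_second_diff_le {P ℓ₂ : ℝ} (hP : ∀ k, k < L → |p k| ≤ P) (hℓ₂ : 0 ≤ ℓ₂)
    (h2 : ∀ j, j < L → |p (((j + 1) % L + 1) % L) - 2 * p ((j + 1) % L) + p j| ≤ ℓ₂) (x : TSite d (fineP L m)) (μ : Fin d) :
    |(∏ ν, p (offset L m x ν) - ∏ ν, p (offset L m (unshift μ x) ν)) - (∏ ν, p (offset L m (shift μ x) ν) - ∏ ν, p (offset L m x ν))| ≤
      ℓ₂ * P ^ (d - 1) := by
  obtain ⟨hun, hj⟩ := prod_offset_unshift_eq L m p x μ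
  rw [prod_offset_shift_eq L m p x μ, prod_offset_eq L m p x μ, hun, ← sub_mul, ← sub_mul, ← sub_mul, abs_mul]
  refine mul_le_mul ?_ (abs_prod_erase_le L m p hP x μ) (abs_nonneg _) hℓ₂
  have h := h2 _ (offset_lt L m (unshift μ x) μ)
  rw [← hj] at h
  rw [show p (offset L m x μ) - p (offset L m (unshift μ x) μ) - (p ((offset L m x μ + 1) % L) - p (offset L m x μ)) =
    -(p ((offset L m x μ + 1) % L) - 2 * p (offset L m x μ) + p (offset L m (unshift μ x) μ)) by ring, abs_neg]
  exact h

/-- **CROSSING BONDS**: if `p(0) = 0 = p(L−1)` then `Πp(k(·))` vanishes at both ends of every block-crossing bond. [folklore] [cite: Balaban1985Averaging, (2) p.17] -/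
theorem prod_offset_cross (hp0 : p 0 = 0) (hpL : p (L - 1) = 0) (b : Bond d (fineP L m)) (h : blockCoord L m (btgt b) ≠ blockCoord L m (bpos b)) :
    (∏ ν, p (offset L m (bpos b) ν)) = 0 ∧ (∏ ν, p (offset L m (btgt b) ν)) = 0 := by
  obtain ⟨x, μ⟩ := b
  have heq : offset L m x μ + 1 = L := by
    have hle : offset L m x μ + 1 ≤ L := offset_lt L m x μ
    rcases hle.lt_or_eq with hlt | heq
    · exact absurd (blockCoord_shift_of_lt L m x hlt).1 h
    · exact heq
  refine ⟨Finset.prod_eq_zero (Finset.mem_univ μ) ?_, Finset.prod_eq_zero (Finset.mem_univ μ) ?_⟩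
  · rw [show bpos (x, μ) = x from rfl, show offset L m x μ = L - 1 by omega, hpL]
  · rw [show btgt (x, μ) = shift μ x from rfl, offset_shift_of_eq L m x heq, hp0]

/-- **BLOCK SUM**: `Σ_{x∈B(y)} Π_ν p(k_ν(x)) = (Σ_{k<L} p k)^d` (the sum of a product of one-coordinate functions factorises). [folklore]
[cite: Balaban1985Averaging, (2) p.17; Balaban1984PropagatorsII, (2.74)–(2.77) p.236] -/
theorem sum_blockOf_prod_offset [∀ i, NeZero (fineP L m i)] (y : TSite d m) :
    ∑ x ∈ B9Eq319QprimeTorus.blockOf L m y, ∏ ν, p (offset L m x ν) = (∑ k ∈ Finset.range L, p k) ^ d := by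
  rw [sum_blockOf_eq_sum_boxVec]
  simp only [offset_perSite_cornerSite_add_boxVec]
  rw [← Fin.sum_univ_eq_sum_range (fun k => p k) L]
  have h : (∏ _μ : Fin d, ∑ k : Fin L, p (k : ℕ)) = (∑ k : Fin L, p (k : ℕ)) ^ d := by
    rw [Finset.prod_const, Finset.card_univ, Fintype.card_fin]
  rw [← h, Fintype.prod_sum]

end Product

/-! ## §4 The cosine bump on the blocks of the fine torus: the six profile letters -/
section Cos
variable {d : ℕ} (L : ℕ) [NeZero L] (m : Fin d → ℕ)

omit [NeZero L] in
/-- the one-coordinate letters of `q(k) = 1 − cos(θk)` packaged for §3: `|q| ≤ 2`, restart first differences `≤ θ`, restart second differences `≤ θ²`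
(`L ≥ 3`). [folklore] [cite: Balaban1985BackgroundPropagators, (3.100) p.413] -/
theorem cos_profile_letters (hL : 3 ≤ L) :
    (∀ k, k < L → |1 - Real.cos (2 * Real.pi / ((L : ℝ) - 1) * (k : ℝ))| ≤ 2) ∧
      (∀ k, k < L → |(1 - Real.cos (2 * Real.pi / ((L : ℝ) - 1) * (((k + 1) % L : ℕ) : ℝ))) -
        (1 - Real.cos (2 * Real.pi / ((L : ℝ) - 1) * (k : ℝ)))| ≤ 2 * Real.pi / ((L : ℝ) - 1)) ∧
      (∀ j, j < L → |(1 - Real.cos (2 * Real.pi / ((L : ℝ) - 1) * ((((j + 1) % L + 1) % L : ℕ) : ℝ))) -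
        2 * (1 - Real.cos (2 * Real.pi / ((L : ℝ) - 1) * (((j + 1) % L : ℕ) : ℝ))) +
        (1 - Real.cos (2 * Real.pi / ((L : ℝ) - 1) * (j : ℝ)))| ≤ (2 * Real.pi / ((L : ℝ) - 1)) ^ 2) :=
  ⟨fun k _ => by rw [abs_of_nonneg (one_sub_cos_mem _).1]; exact (one_sub_cos_mem _).2,
    fun k hk => latt_first_diff_le (by omega) hk rfl, fun j hj => latt_second_diff_le hL hj rfl rfl⟩

/-- **NORMALISATION (`hφ`)**: `Σ_{x∈B(y)} L^{−d}·(L∕(L−1))^d·Π_ν(1 − cos(2πk_ν(x)∕(L−1))) = 1` on every block (`L ≥ 3`). [folklore]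
[cite: Balaban1985BackgroundPropagators, (3.19) p.393; Balaban1985Averaging, (2) p.17] -/
theorem bumpProfileCos_sum [∀ i, NeZero (fineP L m i)] (hL : 3 ≤ L) (y : TSite d m) :
    ∑ x ∈ B9Eq319QprimeTorus.blockOf L m y, ((L : ℝ) ^ d)⁻¹ *
        (((L : ℝ) / ((L : ℝ) - 1)) ^ d * ∏ ν, (1 - Real.cos (2 * Real.pi / ((L : ℝ) - 1) * (offset L m x ν : ℕ)))) = 1 := by
  have h3 : (3 : ℝ) ≤ L := by exact_mod_cast hL
  have hL1 : (L : ℝ) - 1 ≠ 0 := by linarith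
  have hL0 : (L : ℝ) ≠ 0 := by linarith
  simp_rw [← mul_assoc]
  rw [← Finset.mul_sum, sum_blockOf_prod_offset L m (fun k => 1 - Real.cos (2 * Real.pi / ((L : ℝ) - 1) * (k : ℝ))) y, sum_one_sub_cos_eq hL,
    div_pow]
  field_simp

/-- **SIZE (`hΦ`)**: `|φ(x)| ≤ (L∕(L−1))^d·2^d`. [folklore] [cite: Balaban1985Averaging, (2) p.17] -/
theorem abs_bumpProfileCos_le (hL : 3 ≤ L) (x : TSite d (fineP L m)) :
    |((L : ℝ) / ((L : ℝ) - 1)) ^ d * ∏ ν, (1 - Real.cos (2 * Real.pi / ((L : ℝ) - 1) * (offset L m x ν : ℕ)))| ≤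
      ((L : ℝ) / ((L : ℝ) - 1)) ^ d * 2 ^ d := by
  have h3 : (3 : ℝ) ≤ L := by exact_mod_cast hL
  have hC : 0 ≤ ((L : ℝ) / ((L : ℝ) - 1)) ^ d := pow_nonneg (div_nonneg (by linarith) (by linarith)) d
  rw [abs_mul, abs_of_nonneg hC]
  exact mul_le_mul_of_nonneg_left (abs_prod_offset_le L m _ (cos_profile_letters L hL).1 x) hC

/-- **STEP ON EVERY BOND (`hφlip`)**: `|φ(b₊) − φ(b₋)| ≤ (L∕(L−1))^d·(2π∕(L−1))·2^{d−1}` — `O(L⁻¹)` uniformly, faces included. [folklore]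
[cite: Balaban1985BackgroundPropagators, (3.100) p.413; Balaban1985Averaging, (2) p.17] -/
theorem abs_bumpProfileCos_step_le (hL : 3 ≤ L) (b : Bond d (fineP L m)) :
    |((L : ℝ) / ((L : ℝ) - 1)) ^ d * ∏ ν, (1 - Real.cos (2 * Real.pi / ((L : ℝ) - 1) * (offset L m (btgt b) ν : ℕ))) -
        ((L : ℝ) / ((L : ℝ) - 1)) ^ d * ∏ ν, (1 - Real.cos (2 * Real.pi / ((L : ℝ) - 1) * (offset L m (bpos b) ν : ℕ)))| ≤
      ((L : ℝ) / ((L : ℝ) - 1)) ^ d * (2 * Real.pi / ((L : ℝ) - 1) * 2 ^ (d - 1)) := by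
  have h3 : (3 : ℝ) ≤ L := by exact_mod_cast hL
  have hC : 0 ≤ ((L : ℝ) / ((L : ℝ) - 1)) ^ d := pow_nonneg (div_nonneg (by linarith) (by linarith)) d
  have hθ : 0 ≤ 2 * Real.pi / ((L : ℝ) - 1) := div_nonneg (by positivity) (by linarith)
  obtain ⟨hP, h1, -⟩ := cos_profile_letters L hL
  obtain ⟨x, μ⟩ := b
  rw [← mul_sub, abs_mul, abs_of_nonneg hC, show btgt (x, μ) = shift μ x from rfl, show bpos (x, μ) = x from rfl]
  exact mul_le_mul_of_nonneg_left (abs_prod_offset_shift_sub_le L m _ hP hθ h1 x μ) hC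

/-- **CROSSING BONDS (`hcross`)**: the cosine bump vanishes at both ends of every block-crossing bond. [folklore] [cite: Balaban1985Averaging, (2) p.17] -/
theorem bumpProfileCos_cross (hL : 2 ≤ L) (b : Bond d (fineP L m)) (h : blockCoord L m (btgt b) ≠ blockCoord L m (bpos b)) :
    ((L : ℝ) / ((L : ℝ) - 1)) ^ d * ∏ ν, (1 - Real.cos (2 * Real.pi / ((L : ℝ) - 1) * (offset L m (bpos b) ν : ℕ))) = 0 ∧
      ((L : ℝ) / ((L : ℝ) - 1)) ^ d * ∏ ν, (1 - Real.cos (2 * Real.pi / ((L : ℝ) - 1) * (offset L m (btgt b) ν : ℕ))) = 0 := by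
  obtain ⟨h0, hlast⟩ := one_sub_cos_face hL
  obtain ⟨h1, h2⟩ := prod_offset_cross L m (fun k => 1 - Real.cos (2 * Real.pi / ((L : ℝ) - 1) * (k : ℝ))) (by simp) hlast b h
  exact ⟨by rw [h1, mul_zero], by rw [h2, mul_zero]⟩

/-- **SECOND DIFFERENCES AT EVERY SITE (NEW letter)**: `|(φ(y) − φ(y − e_μ)) − (φ(y + e_μ) − φ(y))| ≤ (L∕(L−1))^d·(2π∕(L−1))²·2^{d−1}` — `O(L⁻²)`
uniformly, the block faces INCLUDED (double zero of the cosine bump); the `h2` hypothesis of `B9Eq388KhCommutatorLattice.norm_lap_comm_le` and the datum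
the Laplacian of a bump section needs. [folklore] [cite: Balaban1985BackgroundPropagators, (3.100) p.413, (3.88)–(3.89) p.409] -/
theorem abs_bumpProfileCos_second_diff_le (hL : 3 ≤ L) (y : TSite d (fineP L m)) (μ : Fin d) :
    |(((L : ℝ) / ((L : ℝ) - 1)) ^ d * ∏ ν, (1 - Real.cos (2 * Real.pi / ((L : ℝ) - 1) * (offset L m y ν : ℕ))) -
        ((L : ℝ) / ((L : ℝ) - 1)) ^ d * ∏ ν, (1 - Real.cos (2 * Real.pi / ((L : ℝ) - 1) * (offset L m (unshift μ y) ν : ℕ)))) -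
      (((L : ℝ) / ((L : ℝ) - 1)) ^ d * ∏ ν, (1 - Real.cos (2 * Real.pi / ((L : ℝ) - 1) * (offset L m (shift μ y) ν : ℕ))) -
        ((L : ℝ) / ((L : ℝ) - 1)) ^ d * ∏ ν, (1 - Real.cos (2 * Real.pi / ((L : ℝ) - 1) * (offset L m y ν : ℕ))))| ≤
      ((L : ℝ) / ((L : ℝ) - 1)) ^ d * ((2 * Real.pi / ((L : ℝ) - 1)) ^ 2 * 2 ^ (d - 1)) := by
  have h3 : (3 : ℝ) ≤ L := by exact_mod_cast hL
  have hC : 0 ≤ ((L : ℝ) / ((L : ℝ) - 1)) ^ d := pow_nonneg (div_nonneg (by linarith) (by linarith)) d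
  obtain ⟨hP, -, h2⟩ := cos_profile_letters L hL
  rw [← mul_sub, ← mul_sub, ← mul_sub, abs_mul, abs_of_nonneg hC]
  exact mul_le_mul_of_nonneg_left (abs_prod_offset_second_diff_le L m _ hP (sq_nonneg _) h2 y μ) hC

/-- **THE COSINE BUMP PROFILE EXISTS ON THE BLOCKS OF THE FINE TORUS (`L ≥ 3`)** — the five binders of `B9Eq319BumpProfile.exists_bumpProfile` in the SAME
shapes (`hφ`, `hφlip` on every bond, `hΦ`, `0 ≤ φ`, `hcross`) with `Φ = (L∕(L−1))^d2^d`, `ℓ_φ = (L∕(L−1))^d(2π∕(L−1))2^{d−1}`, PLUS the second-difference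
letter `ℓ₂ = (L∕(L−1))^d(2π∕(L−1))²2^{d−1}` at every site. [folklore] [cite: Balaban1985BackgroundPropagators, (3.19) p.393, (3.100) p.413; Balaban1985Averaging, (2) p.17] -/
theorem exists_bumpProfileCos [∀ i, NeZero (fineP L m i)] (hL : 3 ≤ L) :
    ∃ φ : TSite d (fineP L m) → ℝ,
      (∀ y : TSite d m, ∑ x ∈ B9Eq319QprimeTorus.blockOf L m y, ((L : ℝ) ^ d)⁻¹ * φ x = 1) ∧
      (∀ b : Bond d (fineP L m), |φ (btgt b) - φ (bpos b)| ≤ ((L : ℝ) / ((L : ℝ) - 1)) ^ d * (2 * Real.pi / ((L : ℝ) - 1) * 2 ^ (d - 1))) ∧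
      (∀ x, |φ x| ≤ ((L : ℝ) / ((L : ℝ) - 1)) ^ d * 2 ^ d) ∧
      (∀ x, 0 ≤ φ x) ∧
      (∀ b : Bond d (fineP L m), blockCoord L m (btgt b) ≠ blockCoord L m (bpos b) → φ (bpos b) = 0 ∧ φ (btgt b) = 0) ∧
      (∀ (y : TSite d (fineP L m)) (μ : Fin d), |(φ y - φ (unshift μ y)) - (φ (shift μ y) - φ y)| ≤
        ((L : ℝ) / ((L : ℝ) - 1)) ^ d * ((2 * Real.pi / ((L : ℝ) - 1)) ^ 2 * 2 ^ (d - 1))) := by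
  have h3 : (3 : ℝ) ≤ L := by exact_mod_cast hL
  refine ⟨fun x => ((L : ℝ) / ((L : ℝ) - 1)) ^ d * ∏ ν, (1 - Real.cos (2 * Real.pi / ((L : ℝ) - 1) * (offset L m x ν : ℕ))),
    bumpProfileCos_sum L m hL, abs_bumpProfileCos_step_le L m hL, abs_bumpProfileCos_le L m hL, fun x => ?_, bumpProfileCos_cross L m (by omega),
    abs_bumpProfileCos_second_diff_le L m hL⟩
  exact mul_nonneg (pow_nonneg (div_nonneg (by linarith) (by linarith)) d) (Finset.prod_nonneg fun ν _ => (one_sub_cos_mem _).1)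

omit [NeZero L] in
/-- **`L`-UNIFORM CONSTANTS**: for `L ≥ 3`, `L∕(L−1) ≤ 3∕2` and `2π∕(L−1) ≤ 3π∕L`, so `Φ ≤ 3^d`, `ℓ_φ ≤ (3π∕L)·(3∕2)·3^{d−1}`, `ℓ₂ ≤ (3π∕L)²·(3∕2)·3^{d−1}`:
at the diagonal weight `c = η⁻¹ = L` both `cℓ_φ` and `c²ℓ₂` are bounded uniformly in `L`. [folklore] [cite: Balaban1985BackgroundPropagators, (3.88)–(3.89) p.409] -/
theorem bumpProfileCos_const_le (hL : 3 ≤ L) :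
    (L : ℝ) / ((L : ℝ) - 1) ≤ 3 / 2 ∧ 2 * Real.pi / ((L : ℝ) - 1) ≤ 3 * Real.pi / (L : ℝ) ∧ ((L : ℝ) / ((L : ℝ) - 1)) ^ d * 2 ^ d ≤ 3 ^ d := by
  have h3 : (3 : ℝ) ≤ L := by exact_mod_cast hL
  have hL1 : 0 < (L : ℝ) - 1 := by linarith
  have hL0 : 0 < (L : ℝ) := by linarith
  have hc : (L : ℝ) / ((L : ℝ) - 1) ≤ 3 / 2 := by rw [div_le_div_iff₀ hL1 (by norm_num)]; linarith
  refine ⟨hc, ?_, ?_⟩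
  · rw [div_le_div_iff₀ hL1 hL0]; nlinarith [Real.pi_pos]
  · rw [← mul_pow]
    exact pow_le_pow_left₀ (by positivity) (by linarith) d

end Cos

end Literature.MathematicalPhysics.QuantumFieldTheory.Balaban1983to89.B9Eq319BumpProfileCos

end
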